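import Literature.Topology.FourManifolds.IwaseToriT0
import HarnessLib

/-!
# The second Iwase torus and the exact tube relation `Φ ∘ T₀ ∘ shear = T₁`

Part of the proof of Iwase's Proposition 3.5 [cite: Iwase1988, Prop. 3.5, p. 296].  The second
torus is assembled exactly like the first from the untwisted zone maps `TV1 = TV ∘ (rotV ·)` and
`TH1 = G⁻¹ ∘ TH ∘ (rotH ·)`:

* `gluckInvPD` (the inverse Gluck map as a partial diffeomorphism of `{w ≠ 0}`),
  `Sigma1_eq : Σ₁ = Σ₀` (`G⁻¹` fixes the handle torus pointwise);
* `rotPD` (fibrewise rotation of the direction), `isLocalDiffeomorphAt_TV1/TH1`, the overlap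
  identity `TH1_eq_TV1`, the symmetries `TH1_four_sub`, `TV1_neg`; `Nmap1`, `T1pre`, its local
  forms, `isLocalDiffeomorph_T1pre`, `T1pre_zero : T1pre (x, 0) = T0pre (x, 0)`,
  `exists_injOn_T1pre`;
* `Phi_mirrorM` (`Φ` commutes with the mirror), `Phi_Nmap_shear`, and **the exact tube relation
  on the pre-maps** `Phi_T0pre_shear : Φ (T0pre ((unit(v)·z₁, z₂), v)) = T1pre ((z₁, z₂), v)`
  for `v ≠ 0` — the union of the zone exactness statements `polarMap_TV_shear` and
  `PhiH_TH_shear`.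

All statements are elementary [folklore].

## References
* Z. Iwase, *Dehn-surgery along a torus T²-knot*, Pacific J. Math. 133 (1988), 289–299,
  Prop. 3.5. [cite: Iwase1988]
-/

open scoped ContDiff Topology Manifold
open Set Function Real Filter Metric

noncomputable section

namespace Literature.Topology.FourManifolds

namespace IwaseTori

open IwaseHandle UnknotSurgery

/-! ### The inverse Gluck map as a partial diffeomorphism off the zero plane -/

/-- `{q | q.2 ≠ 0}` is open. [folklore] -/
theorem isOpen_snd_ne_zero : IsOpen {q : sphere (0 : EuclideanSpace ℝ (Fin 3)) 1 × EuclideanSpace ℝ (Fin 2) | q.2 ≠ 0} :=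
  isOpen_ne_fun continuous_snd continuous_const

/-- **The inverse Gluck map `G⁻¹` as a partial diffeomorphism of `{w ≠ 0}`.** [folklore] -/
def gluckInvPD : PartialDiffeomorph ((𝓡 2).prod 𝓘(ℝ, EuclideanSpace ℝ (Fin 2)))
    ((𝓡 2).prod 𝓘(ℝ, EuclideanSpace ℝ (Fin 2)))
    (sphere (0 : EuclideanSpace ℝ (Fin 3)) 1 × EuclideanSpace ℝ (Fin 2))
    (sphere (0 : EuclideanSpace ℝ (Fin 3)) 1 × EuclideanSpace ℝ (Fin 2)) ∞ where
  toFun := gluckMapInv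
  invFun := gluckMap
  source := {q | q.2 ≠ 0}
  target := {q | q.2 ≠ 0}
  map_source' := fun q hq => by change (gluckMapInv q).2 ≠ 0; rwa [gluckMapInv_snd]
  map_target' := fun q hq => by change (gluckMap q).2 ≠ 0; rwa [gluckMap_snd]
  left_inv' := fun _ hq => gluckMap_gluckMapInv hq
  right_inv' := fun _ hq => gluckMapInv_gluckMap hq
  open_source := isOpen_snd_ne_zero
  open_target := isOpen_snd_ne_zero
  contMDiffOn_toFun := contMDiffOn_gluckMapInv
  contMDiffOn_invFun := contMDiffOn_gluckMap_holds

/-- `G⁻¹` fixes points whose plane coordinate is real positive. [folklore] -/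
theorem gluckMapInv_of_toC_pos {q : sphere (0 : EuclideanSpace ℝ (Fin 3)) 1 × EuclideanSpace ℝ (Fin 2)} {r : ℝ}
    (hr : 0 < r) (h : toC q.2 = ↑r) : gluckMapInv q = q := by
  have hq : q.2 ≠ 0 := by
    intro h0; rw [h0] at h
    have : (toC (0 : EuclideanSpace ℝ (Fin 2))).re = r := by rw [h]; simp
    simp [toC] at this; linarith
  rw [gluckMapInv_eq_of_ne_zero hq, ← IwasePolar.circleOf_nrm_toC hq, h, nrm_ofReal_of_pos hr,
    show IwasePolar.circleOf 1 = circlePoint 0 from by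
      apply Subtype.ext; rw [IwasePolar.coe_circleOf (by simp)]; ext i; fin_cases i <;> simp [circlePoint],
    show conjCircle (circlePoint 0) = circlePoint 0 from by
      apply Subtype.ext; ext i; fin_cases i <;> simp [circlePoint],
    rotateSphereTwo_circlePoint_zero]
  rfl

/-- `G⁻¹` fixes the handle core points. [folklore] -/
theorem gluckMapInv_handleMap_core {u : ℝ} (hu : u ∈ Icc (0 : ℝ) 1) {ζ : ℂ} (hζ : ‖ζ‖ ≤ 5 / 2) :
    gluckMapInv (handleMap (u, ζ, 0)) = handleMap (u, ζ, 0) := by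
  refine gluckMapInv_of_toC_pos (rad_pos hu (neg_one_lt_aOf u hζ)) ?_
  change toC (wOf (rad u (aOf u ζ)) 0) = _
  rw [toC_wOf]; simp

/-- **`Σ₁ = Σ₀`**: the inverse Gluck map fixes the handle torus pointwise. [folklore] -/
theorem Sigma1_eq : Sigma1 = Sigma0 := by
  have hH : gluckMapInv '' SigmaH = SigmaH := by
    have hfix : ∀ q ∈ SigmaH, gluckMapInv q = q := by
      rintro _ ⟨⟨u, ζ, c⟩, ⟨⟨hu, hζ, -⟩, ⟨hζ1, hc⟩⟩, rfl⟩
      simp only at hu hζ hζ1 hc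
      subst hc
      exact gluckMapInv_handleMap_core ⟨hu.1.le, hu.2.le⟩ (by linarith)
    apply Subset.antisymm
    · rintro _ ⟨q, hq, rfl⟩; rw [hfix q hq]; exact hq
    · intro q hq; exact ⟨q, hq, hfix q hq⟩
  rw [Sigma1, hH, Sigma0]

/-! ### Fibrewise rotations of the direction as partial diffeomorphisms -/

/-- **Rotating the direction by a smooth circle-valued function of the fibre coordinate** is a
partial diffeomorphism of `S¹ × ℝ × ℂ` on `‖ν‖ < 1`. [folklore] -/
def rotPD (R : ℂ → sphere (0 : EuclideanSpace ℝ (Fin 2)) 1)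
    (hR : ∀ ν : ℂ, ‖ν‖ < 1 → ContMDiffAt 𝓘(ℝ, ℂ) (𝓡 1) ∞ R ν) :
    PartialDiffeomorph ((𝓡 1).prod 𝓘(ℝ, ℝ × ℂ)) ((𝓡 1).prod 𝓘(ℝ, ℝ × ℂ))
      (sphere (0 : EuclideanSpace ℝ (Fin 2)) 1 × ℝ × ℂ) (sphere (0 : EuclideanSpace ℝ (Fin 2)) 1 × ℝ × ℂ) ∞ where
  toFun p := (circleMul (R p.2.2) p.1, p.2)
  invFun p := (circleMul (conjCircle (R p.2.2)) p.1, p.2)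
  source := {p | ‖p.2.2‖ < 1}
  target := {p | ‖p.2.2‖ < 1}
  map_source' := fun _ hp => hp
  map_target' := fun _ hp => hp
  left_inv' := fun p _ => by simp
  right_inv' := fun p _ => by simp
  open_source := isOpen_lt (continuous_norm.comp (continuous_snd.comp continuous_snd)) continuous_const
  open_target := isOpen_lt (continuous_norm.comp (continuous_snd.comp continuous_snd)) continuous_const
  contMDiffOn_toFun := by
    rintro ⟨z, t, ν⟩ hp
    have hν : ‖ν‖ < 1 := hp
    have h2 : ContMDiffAt ((𝓡 1).prod 𝓘(ℝ, ℝ × ℂ)) 𝓘(ℝ, ℂ) ∞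
        (fun p : sphere (0 : EuclideanSpace ℝ (Fin 2)) 1 × ℝ × ℂ => p.2.2) (z, t, ν) :=
      (contDiff_snd.contMDiff.contMDiffAt).comp _ contMDiffAt_snd
    have hRp : ContMDiffAt ((𝓡 1).prod 𝓘(ℝ, ℝ × ℂ)) (𝓡 1) ∞
        (fun p : sphere (0 : EuclideanSpace ℝ (Fin 2)) 1 × ℝ × ℂ => R p.2.2) (z, t, ν) := (hR ν hν).comp _ h2
    have hmul := contMDiff_circleMul.contMDiffAt.comp (z, t, ν) (hRp.prodMk contMDiffAt_fst)
    exact (hmul.prodMk contMDiffAt_snd).contMDiffWithinAt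
  contMDiffOn_invFun := by
    rintro ⟨z, t, ν⟩ hp
    have hν : ‖ν‖ < 1 := hp
    have h2 : ContMDiffAt ((𝓡 1).prod 𝓘(ℝ, ℝ × ℂ)) 𝓘(ℝ, ℂ) ∞
        (fun p : sphere (0 : EuclideanSpace ℝ (Fin 2)) 1 × ℝ × ℂ => p.2.2) (z, t, ν) :=
      (contDiff_snd.contMDiff.contMDiffAt).comp _ contMDiffAt_snd
    have hRp : ContMDiffAt ((𝓡 1).prod 𝓘(ℝ, ℝ × ℂ)) (𝓡 1) ∞
        (fun p : sphere (0 : EuclideanSpace ℝ (Fin 2)) 1 × ℝ × ℂ => conjCircle (R p.2.2)) (z, t, ν) :=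
      contMDiff_conjCircle.contMDiffAt.comp _ ((hR ν hν).comp _ h2)
    have hmul := contMDiff_circleMul.contMDiffAt.comp (z, t, ν) (hRp.prodMk contMDiffAt_fst)
    exact (hmul.prodMk contMDiffAt_snd).contMDiffWithinAt

/-- `TV₁ = TV ∘ rotPD rotV`. [folklore] -/
theorem TV1_eq (p : sphere (0 : EuclideanSpace ℝ (Fin 2)) 1 × ℝ × ℂ) :
    TV1 p = TV (rotPD rotV (fun _ h => contMDiffAt_rotV h) p) := rfl

/-- `TH₁ = G⁻¹ ∘ TH ∘ rotPD rotH`. [folklore] -/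
theorem TH1_eq (p : sphere (0 : EuclideanSpace ℝ (Fin 2)) 1 × ℝ × ℂ) :
    TH1 p = gluckMapInv (TH (rotPD rotH (fun _ h => contMDiffAt_rotH h) p)) := rfl

/-- **`TV₁` is a local diffeomorphism** on the graph zone. [folklore] -/
theorem isLocalDiffeomorphAt_TV1 {p : sphere (0 : EuclideanSpace ℝ (Fin 2)) 1 × ℝ × ℂ}
    (ht : zoneV p.2.1) (hν : ‖p.2.2‖ < nuMax) :
    IsLocalDiffeomorphAt ((𝓡 1).prod 𝓘(ℝ, ℝ × ℂ)) ((𝓡 2).prod 𝓘(ℝ, EuclideanSpace ℝ (Fin 2))) ∞ TV1 p := by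
  have hν1 : ‖p.2.2‖ < 1 := by linarith [nuMax_le]
  have h1 := (rotPD rotV (fun _ h => contMDiffAt_rotV h)).isLocalDiffeomorphAt _ _ _ (show p ∈ (rotPD rotV _).source from hν1)
  have h2 := isLocalDiffeomorphAt_TV (p := rotPD rotV (fun _ h => contMDiffAt_rotV h) p)
    (xiV_mem_Ioo ht hν.le) hν
  exact IsLocalDiffeomorphAt.comp (hf := h1) (hg := h2)

/-- **`TH₁` is a local diffeomorphism** on the handle zone. [folklore] -/
theorem isLocalDiffeomorphAt_TH1 {p : sphere (0 : EuclideanSpace ℝ (Fin 2)) 1 × ℝ × ℂ}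
    (ht : zoneH p.2.1) (hν : ‖p.2.2‖ < nuMax) :
    IsLocalDiffeomorphAt ((𝓡 1).prod 𝓘(ℝ, ℝ × ℂ)) ((𝓡 2).prod 𝓘(ℝ, EuclideanSpace ℝ (Fin 2))) ∞ TH1 p := by
  have hν1 : ‖p.2.2‖ < 1 := by linarith [nuMax_le]
  have h1 := (rotPD rotH (fun _ h => contMDiffAt_rotH h)).isLocalDiffeomorphAt _ _ _ (show p ∈ (rotPD rotH _).source from hν1)
  have h2 := isLocalDiffeomorphAt_TH (p := rotPD rotH (fun _ h => contMDiffAt_rotH h) p) ht hν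
  have hmem : TH (rotPD rotH (fun _ h => contMDiffAt_rotH h) p) ∈ gluckInvPD.source := by
    obtain ⟨z, t, ν⟩ := p
    exact snd_ne_zero_of_mem_Hset (TH_mem_Hset ht hν.le)
  have h3 := gluckInvPD.isLocalDiffeomorphAt _ _ _ hmem
  have h12 := IsLocalDiffeomorphAt.comp (hf := h1) (hg := h2)
  exact IsLocalDiffeomorphAt.comp (hf := h12) (hg := h3)

/-! ### The overlap identity and the symmetries of the second torus -/

/-- `nrm (e^{-ν}) = e^{-i Im ν}`. [folklore] -/
theorem nrm_exp_neg (ν : ℂ) : nrm (Complex.exp (-ν)) = Complex.exp (-(↑ν.im * Complex.I)) := by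
  have h : (↑‖Complex.exp (-ν)‖ : ℂ)⁻¹ = Complex.exp (↑ν.re) := by
    rw [Complex.norm_exp, Complex.neg_re, ← Complex.ofReal_inv, ← Real.exp_neg, neg_neg, Complex.ofReal_exp]
  rw [show nrm (Complex.exp (-ν)) = (↑‖Complex.exp (-ν)‖ : ℂ)⁻¹ * Complex.exp (-ν) from by
    apply Complex.ext <;> simp [nrm_re, nrm_im], h, ← Complex.exp_add]
  congr 1
  apply Complex.ext <;> simp

/-- The correcting rotations are related by `rotH ν = circleOf (e^{i Im ν}) · rotV ν`. [folklore] -/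
theorem rotH_eq {ν : ℂ} (hν : ‖ν‖ < 1) :
    rotH ν = circleMul (IwasePolar.circleOf (Complex.exp (↑ν.im * Complex.I))) (rotV ν) := by
  have hE := Efun_ne_zero hν
  have hunitE : ‖(nrm (Efun ν))⁻¹‖ = 1 := by rw [norm_inv, norm_nrm hE, inv_one]
  have hunitb : ‖Complex.exp (↑ν.im * Complex.I)‖ = 1 := by rw [Complex.norm_exp_ofReal_mul_I]
  rw [rotH, rotV, circleMul_circleOf hunitb hunitE, nrm_mul, mul_inv, nrm_exp_neg, ← Complex.exp_neg, neg_neg]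

/-- The unit vector of a plane coordinate `t² e^{ib}`. [folklore] -/
theorem unitVector₀_toE_junction {t : ℝ} (ht : 0 < t) (b : ℝ) :
    unitVector₀ (IwasePolar.toE (↑(t ^ 2) * Complex.exp (↑b * Complex.I))) =
      IwasePolar.circleOf (Complex.exp (↑b * Complex.I)) := by
  have hne : IwasePolar.toE (↑(t ^ 2) * Complex.exp (↑b * Complex.I)) ≠ 0 := by
    rw [← norm_ne_zero_iff, IwasePolar.norm_toE, norm_mul, Complex.norm_real, Complex.norm_exp_ofReal_mul_I,
      mul_one, Real.norm_of_nonneg (sq_nonneg _)]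
    positivity
  rw [← IwasePolar.circleOf_nrm_toC hne, IwasePolar.toC_toE, nrm_ofReal_mul (by positivity),
    nrm_of_norm_eq_one (by rw [Complex.norm_exp_ofReal_mul_I])]

/-- **The overlap identity for the second torus**: `TH₁ = TV₁` on the junction. [folklore] -/
theorem TH1_eq_TV1 {z : sphere (0 : EuclideanSpace ℝ (Fin 2)) 1} {t : ℝ} {ν : ℂ}
    (h1 : Real.sqrt (49 / 50) < t) (h2 : zoneV t) (hν : ‖ν‖ ≤ nuMax) : TH1 (z, t, ν) = TV1 (z, t, ν) := by
  obtain ⟨-, -, ht0, -⟩ := junction_bounds h1 h2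
  have hν1 : ‖ν‖ < 1 := by linarith [nuMax_le]
  have hb : ‖Complex.exp (↑ν.im * Complex.I)‖ = 1 := by rw [Complex.norm_exp_ofReal_mul_I]
  rw [TH1, TV1]
  simp only
  rw [TH_eq_TV h1 h2 hν, TV_circleMul, TV_circleMul]
  set q := TV (z, t, ν) with hq
  have hw : q.2 = IwasePolar.toE (↑(t ^ 2) * Complex.exp (↑ν.im * Complex.I)) := by
    rw [hq, TV]; simp only; rw [WV_junction h1 h2 hν]
  have hne : q.2 ≠ 0 := by
    rw [hw, ← norm_ne_zero_iff, IwasePolar.norm_toE, norm_mul, Complex.norm_real, hb, mul_one,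
      Real.norm_of_nonneg (sq_nonneg _)]
    positivity
  rw [gluckMapInv_eq_of_ne_zero (by exact hne)]
  simp only
  rw [hw, unitVector₀_toE_junction ht0, rotateSphereTwo_rotateSphereTwo, rotH_eq hν1, ← circleMul_assoc,
    ← IwasePolar.circleOf_inv hb, circleMul_circleOf (by rw [norm_inv, hb, inv_one]) hb,
    inv_mul_cancel₀ (Complex.exp_ne_zero _)]
  congr 2
  have : IwasePolar.circleOf 1 = circlePoint 0 := by
    apply Subtype.ext; rw [IwasePolar.coe_circleOf (by simp)]; ext i; fin_cases i <;> simp [circlePoint]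
  rw [this, circleMul_circlePoint_zero_left]

/-- **Mirror symmetry of `TH₁` about the top of the handle.** [folklore] -/
theorem TH1_four_sub {z : sphere (0 : EuclideanSpace ℝ (Fin 2)) 1} {t : ℝ} (h1 : 11 / 10 ≤ t)
    (h2 : t ≤ 29 / 10) (ν : ℂ) : TH1 (z, 4 - t, ν) = mirrorM (TH1 (z, t, ν)) := by
  rw [TH1, TH1]
  simp only
  rw [TH_four_sub h1 h2]
  generalize TH (circleMul (rotH ν) z, t, ν) = q
  obtain ⟨P, w⟩ := q
  change gluckMapInv (mirrorS2 P, w) = mirrorM (gluckMapInv (P, w))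
  rw [gluckMapInv_mirror]
  refine Prod.ext rfl ?_
  simp [mirrorM]

/-- **Mirror symmetry of `TV₁` in the graph zone.** [folklore] -/
theorem TV1_neg {z : sphere (0 : EuclideanSpace ℝ (Fin 2)) 1} {t : ℝ} {ν : ℂ} (ht : zoneV t)
    (hν : ‖ν‖ ≤ nuMax) : TV1 (z, -t, ν) = mirrorM (TV1 (z, t, ν)) := by
  rw [TV1, TV1]
  simp only
  exact TV_neg' ht hν

/-! ### The half-torus map of the second torus -/

/-- **The half-torus map of the second torus.** [folklore] -/
def Nmap1 (p : sphere (0 : EuclideanSpace ℝ (Fin 2)) 1 × ℝ × ℂ) :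
    sphere (0 : EuclideanSpace ℝ (Fin 3)) 1 × EuclideanSpace ℝ (Fin 2) :=
  if p.2.1 < tSw then TV1 p else TH1 p

/-- Values below the switch. [folklore] -/
theorem Nmap1_of_lt {p : sphere (0 : EuclideanSpace ℝ (Fin 2)) 1 × ℝ × ℂ} (h : p.2.1 < tSw) : Nmap1 p = TV1 p := by
  simp [Nmap1, h]

/-- Values above the switch. [folklore] -/
theorem Nmap1_of_le {p : sphere (0 : EuclideanSpace ℝ (Fin 2)) 1 × ℝ × ℂ} (h : tSw ≤ p.2.1) : Nmap1 p = TH1 p := by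
  simp [Nmap1, not_lt.2 h]

/-- Near a graph-zone point the half-torus map is `TV₁`. [folklore] -/
theorem Nmap1_eventuallyEq_TV1 {p : sphere (0 : EuclideanSpace ℝ (Fin 2)) 1 × ℝ × ℂ} (ht : zoneV p.2.1)
    (hν : ‖p.2.2‖ < nuMax) : Nmap1 =ᶠ[𝓝 p] TV1 := by
  have ho : IsOpen {q : sphere (0 : EuclideanSpace ℝ (Fin 2)) 1 × ℝ × ℂ | zoneV q.2.1 ∧ ‖q.2.2‖ < nuMax} := by
    refine IsOpen.inter ?_ (isOpen_lt (continuous_norm.comp (continuous_snd.comp continuous_snd)) continuous_const)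
    exact isOpen_lt ((continuous_pow 2).comp (continuous_fst.comp continuous_snd)) continuous_const
  filter_upwards [ho.mem_nhds ⟨ht, hν⟩] with q hq
  obtain ⟨z, t, ν⟩ := q
  obtain ⟨hV, hn⟩ := hq
  by_cases h : t < tSw
  · simp [Nmap1, h]
  · simp only [Nmap1, h, if_false]
    push Not at h
    exact TH1_eq_TV1 (lt_of_lt_of_le sqrt_lt_tSw h) hV hn.le

/-- Near a handle-zone point above `√(49/50)` the half-torus map is `TH₁`. [folklore] -/
theorem Nmap1_eventuallyEq_TH1 {p : sphere (0 : EuclideanSpace ℝ (Fin 2)) 1 × ℝ × ℂ}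
    (ht : Real.sqrt (49 / 50) < p.2.1) (hν : ‖p.2.2‖ < nuMax) : Nmap1 =ᶠ[𝓝 p] TH1 := by
  have ho : IsOpen {q : sphere (0 : EuclideanSpace ℝ (Fin 2)) 1 × ℝ × ℂ |
      Real.sqrt (49 / 50) < q.2.1 ∧ ‖q.2.2‖ < nuMax} :=
    (isOpen_lt continuous_const (continuous_fst.comp continuous_snd)).inter
      (isOpen_lt (continuous_norm.comp (continuous_snd.comp continuous_snd)) continuous_const)
  filter_upwards [ho.mem_nhds ⟨ht, hν⟩] with q hq
  obtain ⟨z, t, ν⟩ := q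
  obtain ⟨hH, hn⟩ := hq
  by_cases h : t < tSw
  · simp only [Nmap1, h, if_true]
    have hV : zoneV t := zoneV_of_abs_lt (by
      rw [abs_lt]; exact ⟨by linarith [Real.sqrt_nonneg (49 / 50), tSw.eq_def ▸ (show (0:ℝ) < 1981/2000 by norm_num)], h⟩)
    exact (TH1_eq_TV1 hH hV hn.le).symm
  · simp [Nmap1, h]

/-- **The half-torus map of the second torus is a local diffeomorphism on its good set.** [folklore] -/
theorem isLocalDiffeomorphAt_Nmap1 {p : sphere (0 : EuclideanSpace ℝ (Fin 2)) 1 × ℝ × ℂ} (hp : NGood p) :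
    IsLocalDiffeomorphAt ((𝓡 1).prod 𝓘(ℝ, ℝ × ℂ)) ((𝓡 2).prod 𝓘(ℝ, EuclideanSpace ℝ (Fin 2))) ∞ Nmap1 p := by
  obtain ⟨hz | hz, hν⟩ := hp
  · exact isLocalDiffeomorphAt_congr_nhds' (isLocalDiffeomorphAt_TV1 hz hν) (Nmap1_eventuallyEq_TV1 hz hν)
  · exact isLocalDiffeomorphAt_congr_nhds' (isLocalDiffeomorphAt_TH1 hz hν) (Nmap1_eventuallyEq_TH1 hz.1 hν)

/-! ### The pre-map of the second torus -/

open Classical in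
/-- **The pre-map of the second torus** on `T² × ℝ²`. [folklore] -/
def T1pre (x : (sphere (0 : EuclideanSpace ℝ (Fin 2)) 1 × sphere (0 : EuclideanSpace ℝ (Fin 2)) 1) ×
    EuclideanSpace ℝ (Fin 2)) : sphere (0 : EuclideanSpace ℝ (Fin 3)) 1 × EuclideanSpace ℝ (Fin 2) :=
  if angA x.1.2 ≤ 1 / 2 then Nmap1 (x.1.1, tB x.1.2, nuOfV x.2)
  else mirrorM (Nmap1 (x.1.1, -tB x.1.2, nuOfV x.2))

/-- Local form 1 (upper open half). [folklore] -/
theorem T1pre_eventuallyEq_upper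
    {x : (sphere (0 : EuclideanSpace ℝ (Fin 2)) 1 × sphere (0 : EuclideanSpace ℝ (Fin 2)) 1) × EuclideanSpace ℝ (Fin 2)}
    (hx : angA x.1.2 < 1 / 2) :
    T1pre =ᶠ[𝓝 x] fun x => Nmap1 (x.1.1, tB x.1.2, nuOfV x.2) := by
  have ho : IsOpen {x : (sphere (0 : EuclideanSpace ℝ (Fin 2)) 1 × sphere (0 : EuclideanSpace ℝ (Fin 2)) 1) ×
      EuclideanSpace ℝ (Fin 2) | angA x.1.2 < 1 / 2} :=
    isOpen_angA_lt.preimage (continuous_snd.comp continuous_fst)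
  filter_upwards [ho.mem_nhds hx] with y hy
  rw [T1pre, if_pos (le_of_lt hy)]

/-- Local form 2 (lower open half). [folklore] -/
theorem T1pre_eventuallyEq_lower
    {x : (sphere (0 : EuclideanSpace ℝ (Fin 2)) 1 × sphere (0 : EuclideanSpace ℝ (Fin 2)) 1) × EuclideanSpace ℝ (Fin 2)}
    (hx : 1 / 2 < angA x.1.2) (hA : x.1.2 ≠ ptA) :
    T1pre =ᶠ[𝓝 x] fun x => mirrorM (Nmap1 (x.1.1, -tB x.1.2, nuOfV x.2)) := by
  have ho : IsOpen {x : (sphere (0 : EuclideanSpace ℝ (Fin 2)) 1 × sphere (0 : EuclideanSpace ℝ (Fin 2)) 1) ×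
      EuclideanSpace ℝ (Fin 2) | x.1.2 ≠ ptA ∧ 1 / 2 < angA x.1.2} :=
    isOpen_angA_gt.preimage (continuous_snd.comp continuous_fst)
  filter_upwards [ho.mem_nhds ⟨hA, hx⟩] with y hy
  rw [T1pre, if_neg (not_le.2 hy.2)]

/-- Local form 3 (near the top of the handle). [folklore] -/
theorem T1pre_eventuallyEq_top
    {x : (sphere (0 : EuclideanSpace ℝ (Fin 2)) 1 × sphere (0 : EuclideanSpace ℝ (Fin 2)) 1) × EuclideanSpace ℝ (Fin 2)}
    (hx : tA x.1.2 ∈ Ioo (11 / 10 : ℝ) (29 / 10)) :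
    T1pre =ᶠ[𝓝 x] fun x => TH1 (x.1.1, tA x.1.2, nuOfV x.2) := by
  have hA0 : x.1.2 ≠ ptA := fun h => by
    rw [h, tA, (angA_eq_one_iff _).2 rfl] at hx; norm_num at hx
  have ho : IsOpen {y : (sphere (0 : EuclideanSpace ℝ (Fin 2)) 1 × sphere (0 : EuclideanSpace ℝ (Fin 2)) 1) ×
      EuclideanSpace ℝ (Fin 2) | y.1.2 ≠ ptA ∧ tA y.1.2 ∈ Ioo (11 / 10 : ℝ) (29 / 10)} := by
    have hc : ContinuousOn tA {z : sphere (0 : EuclideanSpace ℝ (Fin 2)) 1 | z ≠ ptA} :=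
      fun _ hz => (contMDiffAt_tA hz).continuousAt.continuousWithinAt
    exact (hc.isOpen_inter_preimage isOpen_ne isOpen_Ioo).preimage (continuous_snd.comp continuous_fst)
  filter_upwards [ho.mem_nhds ⟨hA0, hx⟩] with y hy
  obtain ⟨⟨z₁, z₂⟩, v⟩ := y
  obtain ⟨hA, h1, h2⟩ := hy
  simp only at hA h1 h2 ⊢
  have htsw : tSw < 11 / 10 := by norm_num [tSw]
  by_cases hle : angA z₂ ≤ 1 / 2
  · rw [T1pre, if_pos hle]
    have htB : tB z₂ = tA z₂ := by
      rcases hle.lt_or_eq with h | h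
      · exact tB_eq_tA_of_lt h
      · rw [(angA_eq_half_iff _).1 h]; simp
    simp only
    rw [htB, Nmap1_of_le (by simp only; linarith)]
  · rw [T1pre, if_neg hle]
    push Not at hle
    have htB : tB z₂ = tA z₂ - 4 := tB_eq_tA_sub_of_gt hle hA
    simp only
    rw [htB, Nmap1_of_le (by simp only; linarith), show -(tA z₂ - 4) = 4 - tA z₂ by ring,
      TH1_four_sub h1.le h2.le, mirrorM_mirrorM]

/-- Local form 4 (near the equator heights). [folklore] -/
theorem T1pre_eventuallyEq_equator
    {x : (sphere (0 : EuclideanSpace ℝ (Fin 2)) 1 × sphere (0 : EuclideanSpace ℝ (Fin 2)) 1) × EuclideanSpace ℝ (Fin 2)}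
    (hx : |tB x.1.2| < tSw) :
    T1pre =ᶠ[𝓝 x] fun x => TV1 (x.1.1, tB x.1.2, nuOfV x.2) := by
  have hB0 : x.1.2 ≠ ptB := fun h => by
    rw [h, tB_ptB, tSw] at hx; norm_num [abs_of_pos] at hx
  have ho : IsOpen {y : (sphere (0 : EuclideanSpace ℝ (Fin 2)) 1 × sphere (0 : EuclideanSpace ℝ (Fin 2)) 1) ×
      EuclideanSpace ℝ (Fin 2) | y.1.2 ≠ ptB ∧ |tB y.1.2| < tSw} := by
    have hc : ContinuousOn (fun z => |tB z|) {z : sphere (0 : EuclideanSpace ℝ (Fin 2)) 1 | z ≠ ptB} :=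
      fun _ hz => (continuous_abs.continuousAt.comp (contMDiffAt_tB hz).continuousAt).continuousWithinAt
    exact (hc.isOpen_inter_preimage isOpen_ne (isOpen_Iio (a := tSw))).preimage (continuous_snd.comp continuous_fst)
  filter_upwards [ho.mem_nhds ⟨hB0, hx⟩] with y hy
  obtain ⟨⟨z₁, z₂⟩, v⟩ := y
  obtain ⟨_, h1⟩ := hy
  simp only at h1 ⊢
  obtain ⟨h1a, h1b⟩ := abs_lt.1 h1
  by_cases hle : angA z₂ ≤ 1 / 2
  · rw [T1pre, if_pos hle]
    simp only
    rw [Nmap1_of_lt (by simp only; exact h1b)]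
  · rw [T1pre, if_neg hle]
    simp only
    rw [Nmap1_of_lt (by simp only; linarith), TV1_neg (zoneV_of_abs_lt h1) (norm_nuOfV_lt v).le, mirrorM_mirrorM]

/-- **The pre-map of the second torus is a local diffeomorphism everywhere.** [folklore] -/
theorem isLocalDiffeomorph_T1pre :
    IsLocalDiffeomorph (((𝓡 1).prod (𝓡 1)).prod 𝓘(ℝ, EuclideanSpace ℝ (Fin 2)))
      ((𝓡 2).prod 𝓘(ℝ, EuclideanSpace ℝ (Fin 2))) ∞ T1pre := by
  intro x
  have hν : ‖nuOfV x.2‖ < nuMax := norm_nuOfV_lt x.2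
  rcases cover x.1.2 with h | ⟨h, hA⟩ | h | h
  · have hB : x.1.2 ≠ ptB := fun h' => by rw [(angA_eq_half_iff _).2 h'] at h; norm_num at h
    have h1 := isLocalDiffeomorphAt_coord (x := x) (isLocalDiffeomorphAt_tB hB)
    have hgood : NGood (x.1.1, tB x.1.2, nuOfV x.2) := by
      rw [tB_eq_tA_of_lt h]
      exact NGood_of_mem ⟨(tA_mem _).1, by rw [tA]; linarith⟩ hν _
    have h2 := isLocalDiffeomorphAt_Nmap1 hgood
    exact isLocalDiffeomorphAt_congr_nhds' (IsLocalDiffeomorphAt.comp (hf := h1) (hg := h2))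
      (T1pre_eventuallyEq_upper h)
  · have hB : x.1.2 ≠ ptB := fun h' => by rw [(angA_eq_half_iff _).2 h'] at h; norm_num at h
    have h1 := isLocalDiffeomorphAt_coord (x := x) (isLocalDiffeomorphAt_neg_tB hB)
    have hgood : NGood (x.1.1, -tB x.1.2, nuOfV x.2) := by
      rw [tB_eq_tA_sub_of_gt h hA]
      have := angA_lt_one hA
      exact NGood_of_mem ⟨by rw [tA]; linarith [(angA_mem_Ioc x.1.2).2], by rw [tA]; linarith⟩ hν _
    have h2 := isLocalDiffeomorphAt_Nmap1 hgood
    have h3 := mirrorDiffeo.isLocalDiffeomorph (Nmap1 (x.1.1, -tB x.1.2, nuOfV x.2))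
    have h12 := IsLocalDiffeomorphAt.comp (hf := h1) (hg := h2)
    have h123 := IsLocalDiffeomorphAt.comp (hf := h12) (hg := h3)
    exact isLocalDiffeomorphAt_congr_nhds' h123 (T1pre_eventuallyEq_lower h hA)
  · have hA : x.1.2 ≠ ptA := fun h' => by
      rw [h', tA, (angA_eq_one_iff _).2 rfl] at h; norm_num at h
    have h1 := isLocalDiffeomorphAt_coord (x := x) (isLocalDiffeomorphAt_tA hA)
    have hzone : zoneH (tA x.1.2) := by
      have : Real.sqrt (49 / 50) < 1 := by rw [Real.sqrt_lt' (by norm_num)]; norm_num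
      exact ⟨by linarith [h.1], by linarith [h.2]⟩
    have h2 := isLocalDiffeomorphAt_TH1 (p := (x.1.1, tA x.1.2, nuOfV x.2)) hzone hν
    exact isLocalDiffeomorphAt_congr_nhds' (IsLocalDiffeomorphAt.comp (hf := h1) (hg := h2))
      (T1pre_eventuallyEq_top h)
  · have hB : x.1.2 ≠ ptB := fun h' => by rw [h', tB_ptB, tSw] at h; norm_num [abs_of_pos] at h
    have h1 := isLocalDiffeomorphAt_coord (x := x) (isLocalDiffeomorphAt_tB hB)
    have h2 := isLocalDiffeomorphAt_TV1 (p := (x.1.1, tB x.1.2, nuOfV x.2)) (zoneV_of_abs_lt h) hν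
    exact isLocalDiffeomorphAt_congr_nhds' (IsLocalDiffeomorphAt.comp (hf := h1) (hg := h2))
      (T1pre_eventuallyEq_equator h)

/-- The pre-map of the second torus is continuous. [folklore] -/
theorem continuous_T1pre : Continuous T1pre := isLocalDiffeomorph_T1pre.isLocalHomeomorph.continuous

/-! ### The core of the second torus is the core of the first -/

/-- `TH₁ = TH` on the core, for handle parameters in `[0, 1]`. [folklore] -/
theorem TH1_zero_eq {z : sphere (0 : EuclideanSpace ℝ (Fin 2)) 1} {t : ℝ} (ht : loopU t ∈ Icc (0 : ℝ) 1) :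
    TH1 (z, t, 0) = TH (z, t, 0) := by
  rw [TH1_zero, TH_zero]
  exact gluckMapInv_handleMap_core ht (by rw [norm_toC_sphere]; norm_num)

/-- **The two pre-maps agree on the zero section.** [folklore] -/
theorem T1pre_zero (x : sphere (0 : EuclideanSpace ℝ (Fin 2)) 1 × sphere (0 : EuclideanSpace ℝ (Fin 2)) 1) :
    T1pre (x, 0) = T0pre (x, 0) := by
  obtain ⟨z₁, z₂⟩ := x
  obtain ⟨hu0, hu1, -⟩ := uSw_facts
  have key : ∀ {t : ℝ}, t ∈ Icc (0 : ℝ) 2 → Nmap1 (z₁, t, 0) = Nmap (z₁, t, 0) := by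
    intro t ht
    by_cases h : t < tSw
    · rw [Nmap1_of_lt (by exact h), Nmap_of_lt (by exact h), TV1_zero]
    · push Not at h
      rw [Nmap1_of_le (by exact h), Nmap_of_le (by exact h)]
      have := loopU_mem_of_tB h ht.2
      exact TH1_zero_eq ⟨by linarith [this.1], by linarith [this.2]⟩
  simp only [T1pre, T0pre, nuOfV_zero]
  split_ifs with hle
  · exact key ⟨((tB_pos_iff z₂).2 hle).le, (tB_mem z₂).2⟩
  · have : ¬0 < tB z₂ := by rwa [tB_pos_iff]
    rw [key ⟨by linarith, by linarith [(tB_mem z₂).1]⟩]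

/-- The core of the second torus is injective. [folklore] -/
theorem T1pre_core_injective :
    Injective fun x : sphere (0 : EuclideanSpace ℝ (Fin 2)) 1 × sphere (0 : EuclideanSpace ℝ (Fin 2)) 1 =>
      T1pre (x, 0) := by
  intro a b h
  simp only [T1pre_zero] at h
  exact T0pre_core_injective h

/-- The core of the second torus is `Σ₀ (= Σ₁)`. [folklore] -/
theorem range_T1pre_core :
    range (fun x : sphere (0 : EuclideanSpace ℝ (Fin 2)) 1 × sphere (0 : EuclideanSpace ℝ (Fin 2)) 1 =>
      T1pre (x, 0)) = Sigma0 := by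
  rw [← range_T0pre_core]
  congr 1
  funext x
  exact T1pre_zero x

/-- **A uniform tube on which the second pre-map is injective.** [folklore] -/
theorem exists_injOn_T1pre : ∃ ε > 0, InjOn T1pre (univ ×ˢ ball (0 : EuclideanSpace ℝ (Fin 2)) ε) := by
  refine exists_injOn_prod_ball continuous_T1pre T1pre_core_injective fun x => ?_
  obtain ⟨Φ, hx, heq⟩ := isLocalDiffeomorph_T1pre (x, 0)
  refine ⟨Φ.source, Φ.open_source.mem_nhds hx, fun a ha b hb hab => ?_⟩
  exact Φ.injOn ha hb (by rw [← heq ha, ← heq hb]; exact hab)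

/-! ### The exact tube relation `Φ (T₀ (shear b)) = T₁ b` -/

/-- **`Φ` commutes with the mirror.** [folklore] -/
theorem Phi_mirrorM (q : sphere (0 : EuclideanSpace ℝ (Fin 3)) 1 × EuclideanSpace ℝ (Fin 2)) :
    Phi (mirrorM q) = mirrorM (Phi q) := by
  obtain ⟨P, w⟩ := q
  have hH : ((mirrorS2 P, w) : sphere (0 : EuclideanSpace ℝ (Fin 3)) 1 × EuclideanSpace ℝ (Fin 2)) ∈ Hset ↔
      ((P, w) : sphere (0 : EuclideanSpace ℝ (Fin 3)) 1 × EuclideanSpace ℝ (Fin 2)) ∈ Hset := by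
    constructor
    · intro h; have := mirror_mem_Hset h; simpa using this
    · intro h; exact mirror_mem_Hset h
  simp only [mirrorM]
  by_cases hN : ‖w‖ < 197 / 200
  · rw [Phi_of_N (q := (mirrorS2 P, w)) hN, Phi_of_N (q := (P, w)) hN, polarMap_mirror]; rfl
  by_cases hq : ((P, w) : sphere (0 : EuclideanSpace ℝ (Fin 3)) 1 × EuclideanSpace ℝ (Fin 2)) ∈ Hset
  · rw [Phi_of_H (q := (mirrorS2 P, w)) hN (hH.2 hq), Phi_of_H (q := (P, w)) hN hq, PhiH_mirror hq]
  · rw [Phi_of_ext (q := (mirrorS2 P, w)) hN (fun h => hq (hH.1 h)), Phi_of_ext (q := (P, w)) hN hq,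
      gluckMapInv_mirror, gluckMapInv_snd]

/-- **`Φ` on the sheared half-torus tube is the half-torus tube of the second torus.** [folklore] -/
theorem Phi_Nmap_shear {z : sphere (0 : EuclideanSpace ℝ (Fin 2)) 1} {t : ℝ} (ht : t ∈ Icc (0 : ℝ) 2)
    {v : EuclideanSpace ℝ (Fin 2)} (hv : v ≠ 0) :
    Phi (Nmap (circleMul (unitVector₀ v) z, t, nuOfV v)) = Nmap1 (z, t, nuOfV v) := by
  have hν : ‖nuOfV v‖ ≤ nuMax := (norm_nuOfV_lt v).le
  have hν0 : nuOfV v ≠ 0 := fun h => hv (nuOfV_eq_zero_iff.1 h)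
  by_cases h : t < tSw
  · have hV : zoneV t := zoneV_of_abs_lt (by rw [abs_of_nonneg ht.1]; exact h)
    rw [Nmap_of_lt (by exact h), Nmap1_of_lt (by exact h), Phi_of_N (norm_TV_snd_lt hV hν),
      polarMap_TV_shear hV hv]
  · push Not at h
    have hH : zoneH t := by
      have : Real.sqrt (49 / 50) < 1 := by rw [Real.sqrt_lt' (by norm_num)]; norm_num
      exact ⟨lt_of_lt_of_le sqrt_lt_tSw h, by linarith [ht.2]⟩
    rw [Nmap_of_le (by exact h), Nmap1_of_le (by exact h)]
    have hoff : TH (circleMul (unitVector₀ v) z, t, nuOfV v) ∈ Hoff := by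
      refine ⟨TH_mem_Hset hH hν, ?_⟩
      rw [TH, handleInv_handleMap_of_mem (GH_mem_Ubox hH hν), GH_snd_mem_unknot_iff hν]
      exact hν0
    rw [Phi_of_Hoff hoff, PhiH_TH_shear hH hv]

/-- **The exact tube relation on the pre-maps**: for `v ≠ 0`,
`Φ (T0pre ((unit(v) · z₁, z₂), v)) = T1pre ((z₁, z₂), v)`. [folklore] -/
theorem Phi_T0pre_shear (z₁ z₂ : sphere (0 : EuclideanSpace ℝ (Fin 2)) 1) {v : EuclideanSpace ℝ (Fin 2)} (hv : v ≠ 0) :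
    Phi (T0pre ((circleMul (unitVector₀ v) z₁, z₂), v)) = T1pre ((z₁, z₂), v) := by
  simp only [T0pre, T1pre]
  split_ifs with hle
  · exact Phi_Nmap_shear ⟨((tB_pos_iff z₂).2 hle).le, (tB_mem z₂).2⟩ hv
  · have : ¬0 < tB z₂ := by rwa [tB_pos_iff]
    rw [Phi_mirrorM, Phi_Nmap_shear ⟨by linarith, by linarith [(tB_mem z₂).1]⟩ hv]

end IwaseTori
end Literature.Topology.FourManifolds
end
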